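import Summits.QuantumAdvantage.QuantumAdvantage.Theses.CubicForrelation
import Summits.QuantumAdvantage.QuantumAdvantage.Theorems.NearExactIsExact.Negative.ValueWitnesses
import Summits.QuantumAdvantage.QuantumAdvantage.Theorems.NearExactIsExact.Negative.ProductFourteen

/-!
# A cubic BENT function on 14 bits with a cubic partner at `Φ = 7/8` (stmt-QuantumAdvantage-14043)

Negative-side support (B2b disprover seat `b2b-cforr-disprove-g11`, 2026-08-20).  HONEST FRAMING: a kernel-checked
CERTIFICATE — one explicit cubic pair `(fB, gB)` on `𝔽₂¹⁴` with `gB` bent and `Φ(fB, gB) = 7/8` exactly; it is the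
TIGHTNESS half of the seat's THEOREM BENT14 (`DISPROOF.md` §18: for cubic `f, g` on 14 bits with `g` bent, `Φ(f,g) = 1`
or `Φ(f,g) ≤ 7/8`, by a two-sided flat-congruence ladder, the Kasami–Tokura classification of `f ⊕ g̃` and an `L¹`
bentness inequality — machine certificates, not yet in Lean) and is NOT summit progress (`7/8 < 57/64`, the 14-bit record).
Together with `fo_bent_false` (`CubicForrelationNearExactIsExactFourteenSecondBent.lean`: no bent-sided pair at `15/16`)
the tree now holds `7/8 ≤ sup{Φ(f,g) < 1 : f, g cubic on 14 bits, g bent} ≤ 29/32`; BENT14 says the supremum is `7/8`.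

The pair (Maiorana–McFarland with a QUADRATIC permutation, so that the dual has degree 4 and differs from a cubic by
the indicator of a 10-flat):
* `gB(x,y) = x·π(y) ⊕ y₁y₂y₃` on `7 + 7` bits, `π(z) = (z₄, z₅, z₂, z₃, z₁ ⊕ z₄z₅, z₆, z₇)` (a permutation of `𝔽₂⁷` with
  quadratic inverse `σ(a) = (a₅ ⊕ a₁a₂, a₃, a₄, a₁, a₂, a₆, a₇)`); `gB` is cubic and bent, `|W_gB| ≡ 2⁷` (`gB_bent`), with dual
  `g̃B(a,b) = b·σ(a) ⊕ σ₁σ₂σ₃(a) = b·σ(a) ⊕ a₃a₄a₅ ⊕ a₁a₂a₃a₄` of degree 4;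
* `fB := g̃B ⊕ a₁a₂a₃a₄ = b·σ(a) ⊕ a₃a₄a₅`, cubic; `fB ⊕ g̃B` is the indicator of the 10-flat `{a₁ = a₂ = a₃ = a₄ = 1}`, so
  `Φ(fB, gB) = 1 − 2·2¹⁰/2¹⁴ = 7/8` (`forrelation_fB_gB`).
Coordinates: `x_i ↦ v (i−1)`, `y_i ↦ v (i+6)` (and the same for `(a,b)` on the Walsh side).

`native_decide` evaluates the forrelation sum by the fast Walsh–Hadamard checker `fsumL` (`ValueWitnesses.lean`) and the
bentness by `wal ∘ sigTable` + `bent_of_abs` (`SmallCasesWalsh.lean`): the file is `computational`.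
References: Carlet 2021 §6.1.15 (Maiorana–McFarland bent functions and their duals); Aaronson–Ambainis 2018 §1.1.1.
-/

set_option linter.dupNamespace false -- D-0017: single-problem summit ⇒ `QuantumAdvantage.QuantumAdvantage` by design

namespace Summit.QuantumAdvantage.QuantumAdvantage.Theorems.NearExactIsExact.Negative.BentSevenEighthsFourteen

open Literature.Computability.QuantumComplexity
open Literature.Computability.QuantumComplexity.DerivativeWalsh (W)
open Summit.QuantumAdvantage.QuantumAdvantage.Theorems.SignedExactSliceIsLift.StubMoebius (isDegLeFun_xor)
open Summit.QuantumAdvantage.QuantumAdvantage.Theorems.NearExactIsExact.Negative.SmallCases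
  (fsumL forrelation_eq_fsumL wal sigTable wspec length_wal wal_sigTable bent_of_abs)
open Summit.QuantumAdvantage.QuantumAdvantage.Theorems.NearExactIsExact.Negative.ProductFourteen
  (isDegLeFun_mon3 isDegLeFun_mon2)

/-- `gB(x,y) = x·π(y) ⊕ y₁y₂y₃`, `π(z) = (z₄, z₅, z₂, z₃, z₁ ⊕ z₄z₅, z₆, z₇)`: a cubic Maiorana–McFarland bent function
on `7 + 7` bits. [cite: Carlet2020, §6.1] -/
def gB (v : Fin (7 + 7) → Bool) : Bool :=
  xor (xor (xor (xor (xor (xor (xor (xor (v 0 && v 10) (v 1 && v 11)) (v 2 && v 8)) (v 3 && v 9)) (v 4 && v 7))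
    (v 4 && (v 10 && v 11))) (v 5 && v 12)) (v 6 && v 13)) (v 7 && (v 8 && v 9))

/-- `fB(a,b) = b·σ(a) ⊕ a₃a₄a₅`, `σ = π⁻¹ = (a₅ ⊕ a₁a₂, a₃, a₄, a₁, a₂, a₆, a₇)`: the dual of `gB` plus `a₁a₂a₃a₄`,
cubic. [cite: Carlet2020, §6.1] -/
def fB (u : Fin (7 + 7) → Bool) : Bool :=
  xor (xor (xor (xor (xor (xor (xor (xor (u 7 && u 4) (u 7 && (u 0 && u 1))) (u 8 && u 2)) (u 9 && u 3)) (u 10 && u 0))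
    (u 11 && u 1)) (u 12 && u 5)) (u 13 && u 6)) (u 2 && (u 3 && u 4))

/-! ### Cubicity -/

/-- `gB` is cubic. [cite: Carlet2020, §6.1] -/
theorem isDegLeFun_gB : IsDegLeFun 3 gB := by
  unfold gB
  repeat (first
    | exact isDegLeFun_mon3 _ _ _
    | exact isDegLeFun_mon2 _ _
    | apply isDegLeFun_xor)

/-- `fB` is cubic. [cite: Carlet2020, §6.1] -/
theorem isDegLeFun_fB : IsDegLeFun 3 fB := by
  unfold fB
  repeat (first
    | exact isDegLeFun_mon3 _ _ _
    | exact isDegLeFun_mon2 _ _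
    | apply isDegLeFun_xor)

/-! ### Bentness of `gB` -/

/-- All `2¹⁴` Walsh coefficients of `gB` have absolute value `2⁷` (fast transform, checked by evaluation). [folklore] -/
theorem gB_abs_wal : ((wal (7 + 7) (sigTable (7 + 7) gB)).map Int.natAbs).all (fun w => w == 2 ^ 7) = true := by
  native_decide

/-- `|W_gB(y)| = 2⁷` on codes. [folklore] -/
theorem gB_abs_wspec : ∀ y, y < 2 ^ (7 + 7) → |wspec (7 + 7) gB y| = 2 ^ 7 := by
  intro y hy
  have hlen : (wal (7 + 7) (sigTable (7 + 7) gB)).length = 2 ^ (7 + 7) := length_wal _ _ (by simp [sigTable])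
  have hb := List.all_eq_true.1 gB_abs_wal
  have hmem : Int.natAbs ((wal (7 + 7) (sigTable (7 + 7) gB))[y]?.getD 0) ∈
      (wal (7 + 7) (sigTable (7 + 7) gB)).map Int.natAbs := by
    rw [List.getElem?_eq_getElem (by rw [hlen]; exact hy), Option.getD_some]
    exact List.mem_map.2 ⟨_, List.getElem_mem _, rfl⟩
  have e := beq_iff_eq.1 (hb _ hmem)
  rw [wal_sigTable _ _ _ hy] at e
  rw [Int.abs_eq_natAbs, e]
  push_cast

/-- **`gB` is bent**: `W_gB(x)² = 2¹⁴` for every `x`. [cite: Carlet2020, §6.1] -/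
theorem gB_bent : ∀ x, W (fun y => signOf (gB y)) x ^ 2 = (2 : ℝ) ^ (7 + 7) :=
  bent_of_abs 7 gB gB_abs_wspec

/-! ### Value -/

/-- The forrelation sum of the pair: `7/8 · 2²¹ = 1835008`. [folklore] -/
theorem fsumL_fB_gB : fsumL (7 + 7) fB gB = 1835008 := by native_decide

/-- **`Φ(fB, gB) = 7/8`** at `n = 14`, with `gB` bent. [folklore] -/
theorem forrelation_fB_gB : forrelation fB gB = 7 / 8 := by
  rw [forrelation_eq_fsumL 7 fB gB, fsumL_fB_gB]; norm_num

/-- **A cubic pair on 14 bits with a BENT side and `Φ = 7/8`** (tightness of the seat's THEOREM BENT14). [folklore] -/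
theorem exists_bent_pair_seven_eighths_fourteen :
    ∃ f g : (Fin (7 + 7) → Bool) → Bool, IsDegLeFun 3 f ∧ IsDegLeFun 3 g ∧
      (∀ x, W (fun y => signOf (g y)) x ^ 2 = (2 : ℝ) ^ (7 + 7)) ∧ forrelation f g = 7 / 8 :=
  ⟨fB, gB, isDegLeFun_fB, isDegLeFun_gB, gB_bent, forrelation_fB_gB⟩

/-- Hence no threshold below `7/8` isolates exactness inside the bent-sided class at `n = 14`
(complementing `fo_bent_false`, which excludes the value `15/16` there). [folklore] -/
theorem not_bent_isolation_below_seven_eighths_fourteen {θ : ℝ} (hθ : θ < 7 / 8) :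
    ¬ (∀ f g : (Fin (7 + 7) → Bool) → Bool, IsDegLeFun 3 f → IsDegLeFun 3 g →
        (∀ x, W (fun y => signOf (g y)) x ^ 2 = (2 : ℝ) ^ (7 + 7)) → θ < forrelation f g → forrelation f g = 1) := by
  intro h
  have h1 := h fB gB isDegLeFun_fB isDegLeFun_gB gB_bent (by rw [forrelation_fB_gB]; exact hθ)
  rw [forrelation_fB_gB] at h1
  norm_num at h1

end Summit.QuantumAdvantage.QuantumAdvantage.Theorems.NearExactIsExact.Negative.BentSevenEighthsFourteen
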